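import Literature.MathematicalPhysics.QuantumFieldTheory.Balaban1983to89.B6Ineq2134TransposeLeftFactor
import Literature.MathematicalPhysics.QuantumFieldTheory.Balaban1983to89.B6Ineq2134TransposeKLevelTorus

/-!
# `Balaban1983to89.B6Ineq2134TransposeLeftFactorTorus` — T. Bałaban, *Propagators and renormalization transformations for lattice gauge theories. II*,
# Commun. Math. Phys. **96** (1984) 223–250 [Balaban1984PropagatorsII], (2.134)–(2.135) p. 247 FOR THE REVERSED FAMILY BEHIND AN ARBITRARY LEFT FACTOR
# `Lft_{□′}·K̃_{□,□′}` ON THE GENUINE MULTI-LEVEL TORUS — the generic bounds of `…B6Ineq2134TransposeLeftFactor` packaged on the torus census geometry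
# `geomTB D` with ONE threshold and ONE `Θ`, the printed `O(M⁻¹)` explicit, the indicators `1_{□̃′}(y)·1_{□̃}(y′)` displayed (brick 2 of the programme
# «(2.137)₂ `‖ζG∇*J‖_α` at k levels by the transposed walk»)

statement-level skeleton of published theorems with citation tags; proofs where landed; nothing here is a claim about the Yang–Mills mass gap

PDF held: `paper:balaban1984-cmp96-propagators-rt-ii` (journal page = PDF page + 222); p. 247 [PDF 25] ((2.133)–(2.137), (2.141)), p. 239 [PDF 17]
((2.91)–(2.93)), p. 234 [PDF 12] (Lemma 2.1; Prop. 2.2 (2.67), the scalar precedent of the two Hölder members) re-read this generation; the torus plumbing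
is p38 gen 25–31's (`…B6Ineq2134KLevelTorus`: `ineq263_geomTB`, `thr_geomTB`, `one_le_L_TB` … `levelSepTB`; `…B6Ineq2134TransposeKLevelTorus`: `thetaT_pack_le`).

CITATION HEADER (lean-in-tree rule) — WHAT IS REPRODUCED.  Phase-2 file of the `lit-balaban` typed skeleton (HOME `run/shared/lean/pub/lit-balaban/`), seat
**p38 gen 32**, brick 2 of the programme «(2.137)₂ by the transposed walk» (brick 1 = `…B6Ineq2134TransposeLeftFactor`); SKELETON rows **B6.Eq2.134** ×
B6.Eq2.135 × B6.Eq2.92 × B6.Eq2.93 × B6.Prop2.6 (cells only; decls of record untouched).  THIS FILE = p38 gen 31's `…B6Ineq2134TransposeKLevelTorus` with the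
product `h_{□′}G_{□′}` replaced by an arbitrary family of left factors `Lft_{□′}` (intended: `P_{x,x′}·h_{□′}G_{□′}`, the Hölder pair difference in front):
* §1 **`ineq2134L_kDiag_torus`** — the reversed diagonal term `Lft_□·K̃_{□,□}` (`K̃_{□,□} = kDiagT` BY NAME, `…B6Eq291Transpose`) from the INPUT-side decomposition
  `hdecT` of `[M_□, h_□]`, the GLOBAL majorants `C_L(Lʲη)²e^{−δd}` of `Lft_□` and `C₁(Lʲη)²e^{−δd}` of `Lft_□·E_e`, the output localisation `OutLoc Lft_□ □̃`, the
  coefficient sizes at the input bond, `h_□` block-Lipschitz and supported over `T_□ ⊆ □̃`, partners `N_k`, `P_□`, the input localisations, the transposed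
  line 3: `HasMajorant blk (Lft_□·K̃_{□,□}) (1_{□̃}(y)1_{□̃}(y′)·Θ·U·M⁻¹·e^{−(δ/2)d})` above ONE threshold, `U = #E·s₁C₁ + s₂C_L + (#K+1)·s·((C_N+1)C_L(1+r₀)) + C_DC_L/c_D`;
* §2 **`ineq2134L_kOff_torus`** — the reversed off-diagonal term `Lft_{□′}·K̃_{□,□′}` (`kOffT` BY NAME): `1_{□̃′}(y)1_{□̃}(y′)·Θ·C_PC_L/(mM)·e^{−(δ/2)d}`;
* §3 **`h2134L_kFamT_torus`** — ALL pairs with ONE threshold `M₀` and ONE `Θ`: `θ₀ = Θ·(C_PC_L/m + U)/M`.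
THEOREMS ONLY (no `def`, no `def … : Prop`, no new hypothesis-shaped fact); standard axioms.

HONEST SCOPE / DIVERGENCES.  As the two imported files: abstract carrier `X`, per-cube inputs displayed as hypotheses of the printed shapes; `∂P∂*` a
hypothesis; lattice units; constants depend on `d, L, δ` only; Lemma 2.1 as repaired; the gap read from the inside out.  NEW w.r.t. gen 31: only the
abstraction of the left factor (its majorants and output localisation are hypotheses; the instance is the V1 Hölder file downstream).  Print does not spell
the two-sided walk of (2.137)₂ out; the identity `P·G·∇* = P·G₀·∇* + (P·R̃)·(G∇*)` is OURS (HOME/GAPS.md).  Nothing on d = 4 or the continuum; NOT summit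
progress.  Unit `lit-balaban-p38` (gen 32), 2026-08-23.
-/

namespace Literature.MathematicalPhysics.QuantumFieldTheory.Balaban1983to89.B6Ineq2134TransposeLeftFactorTorus

open Literature.MathematicalPhysics.QuantumFieldTheory.Balaban1983to89.B6MultiLevelTorusOperator (TDomains)
open Literature.MathematicalPhysics.QuantumFieldTheory.Balaban1983to89.B8Ineq192MultiLevelTorus (geomTB geomTB_L geomTB_M levelSepTB)
open Literature.MathematicalPhysics.QuantumFieldTheory.Balaban1983to89.B6Ineq261LevelGap (K261 K261_nonneg)
open Literature.MathematicalPhysics.QuantumFieldTheory.Balaban1983to89.B6RandomWalk (HasMajorant BlockSupp hasMajorant_mono)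
open Literature.MathematicalPhysics.QuantumFieldTheory.Balaban1983to89.B6Prop26Gluing (mulOp mulOp_apply OutLoc InLoc inLoc_mul_mulOp inLoc_mul ind ind_nonneg)
open Literature.MathematicalPhysics.QuantumFieldTheory.Balaban1983to89.B6Ineq268 (LevelSep)
open Literature.MathematicalPhysics.QuantumFieldTheory.Balaban1983to89.B6Lemma21Repaired (Ineq263With)
open Literature.MathematicalPhysics.QuantumFieldTheory.Balaban1983to89.B6InMajorantTransplant (InMajorant)
open Literature.MathematicalPhysics.QuantumFieldTheory.Balaban1983to89.B6Ineq2134OffDiag (theta_le)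
open Literature.MathematicalPhysics.QuantumFieldTheory.Balaban1983to89.B6Ineq2134KLevelTorus
  (one_le_L_TB eta_pos_TB M_pos_TB one_le_RLMh RM_nonneg_TB dist_nonneg_TB ineq263_geomTB thr_geomTB)
open Literature.MathematicalPhysics.QuantumFieldTheory.Balaban1983to89.B6Ineq2134TransposeLeftFactor
  (diagL_hasMajorant compactL_inLoc hasMajorant_ind_of_outLoc_inLoc offDiagL_hasMajorant_ind)
open Literature.MathematicalPhysics.QuantumFieldTheory.Balaban1983to89.B6Ineq2134TransposeKLevelTorus (thetaT_pack_le)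
open Literature.MathematicalPhysics.QuantumFieldTheory.Balaban1983to89.B6Eq291Transpose (kDiagT kOffT kFamT kFamT_of_eq kFamT_of_ne)

variable {d ℓ : ℕ}

/-! ## §1  The reversed diagonal term behind a left factor on the torus -/

/-- **(2.134) FOR THE REVERSED DIAGONAL TERM `Lft_□·K̃_{□,□}` ON THE GENUINE MULTI-LEVEL TORUS, `K̃_{□,□} = kDiagT` BY NAME, THE `O(M⁻¹)` EXPLICIT, WITH
THE INDICATORS `1_{□̃}(y)1_{□̃}(y′)`.**  For every rate `δ > 0` there are a threshold `M₀` and `Θ ≥ 0` (on `d, L, δ` only) such that for every genuine nested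
family `D` with `L·M_h ≥ M₀` and every cube datum of the displayed shapes (the INPUT-side decomposition `hdecT` of `[M_□, h_□]`, the GLOBAL majorants of the
left factor `Lft` and of `Lft·E_e`, its output localisation over `U = □̃`, coefficient sizes read at the input bond, `h_□` block-Lipschitz and supported over
`T` and `U`, partners `N_k`, `P_□` In/Out-localised over `T`, the inputs of `h_□M_□` over `U`, `supp ζ_□ ⊂ U`, the transposed line 3):
`HasMajorant blk (Lft·K̃_{□,□}) (1_U(y)1_U(y′)·Θ·U·M⁻¹·e^{−(δ/2)d})`, `U = #E·s₁C₁ + s₂C_L + (#K+1)·s·((C_N+1)C_L(1+r₀)) + C_DC_L/c_D`.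
[cite: Balaban1984PropagatorsII, (2.134) p.247; (2.92) p.239; (2.133) p.247; (2.137), (2.141) p.247; Lemma 2.1 (2.60), (2.63) p.234] -/
theorem ineq2134L_kDiag_torus (d ℓ : ℕ) {δ : ℝ} (hδ : 0 < δ) :
    ∃ M₀ Θ : ℝ, 0 < M₀ ∧ 0 ≤ Θ ∧
      ∀ {Mh k R : ℕ} {P : Fin (d + 1) → ℕ} (D : TDomains d ℓ Mh k P R), 1 ≤ Mh → (∀ μ, 1 ≤ P μ) → 2 * (ℓ + 1) ≤ R →
        M₀ ≤ ((ℓ : ℝ) + 1) * Mh → ∀ {X : Type} (blk : X → (geomTB D).Site) (Dg : Module.End ℝ (X → ℝ)),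
        ∀ {CL C₁ CN CD cD s s₁ s₂ r₀ : ℝ}, 0 ≤ CL → 0 ≤ C₁ → 0 ≤ CN → 0 ≤ CD → 0 < cD → 0 ≤ s → 0 ≤ s₁ → 0 ≤ s₂ → 0 ≤ r₀ →
        ∀ {Lft Ml Pl : Module.End ℝ (X → ℝ)} {hI c₀ ζ : X → ℝ} {S T U : Set (geomTB D).Site}
          {ι : Type} (DE : Finset ι) {E : ι → Module.End ℝ (X → ℝ)} {cf : ι → X → ℝ}
          {κ : Type} (DK : Finset κ) {N : κ → Module.End ℝ (X → ℝ)} {z : κ → X → ℝ},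
          Ml * mulOp hI - mulOp hI * Ml =
            (∑ e ∈ DE, E e * mulOp (cf e) - mulOp c₀) + ∑ k ∈ DK, (mulOp hI * N k - N k * mulOp hI) * mulOp (z k) →
          HasMajorant blk Lft (fun y y'' => CL * (geomTB D).len y ^ 2 * Real.exp (-(δ * (geomTB D).dist y y''))) →
          (∀ e ∈ DE, HasMajorant blk (Lft * E e) (fun y y' => C₁ * (geomTB D).len y ^ 2 * Real.exp (-(δ * (geomTB D).dist y y')))) →
          OutLoc blk Lft U →
          (∀ e ∈ DE, ∀ x, |cf e x| ≤ s₁ / ((geomTB D).M * (geomTB D).len (blk x) ^ 2)) → (∀ e ∈ DE, ∀ x, cf e x ≠ 0 → blk x ∈ S) →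
          (∀ x, |c₀ x| ≤ s₂ / ((geomTB D).M * (geomTB D).len (blk x) ^ 2)) → (∀ x, c₀ x ≠ 0 → blk x ∈ S) →
          (∀ x, hI x ≠ 0 → blk x ∈ T) → (∀ x, hI x ≠ 0 → blk x ∈ U) →
          (∀ x x', |hI x' - hI x| ≤ s / (geomTB D).M * ((geomTB D).dist (blk x) (blk x') + r₀)) →
          (∀ k ∈ DK, InMajorant blk (N k) T (fun y y'' => CN / (geomTB D).len y ^ 2 * Real.exp (-(δ * (geomTB D).dist y y'')))) →
          (∀ k ∈ DK, ∀ (y'' : (geomTB D).Site) (μ : X → ℝ) (B : ℝ), BlockSupp blk μ y'' B → ∀ x, blk x ∈ T →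
            |N k μ x| ≤ CN / (geomTB D).len (blk x) ^ 2 * Real.exp (-(δ * (geomTB D).dist (blk x) y'')) * B) →
          (∀ k ∈ DK, ∀ x, |z k x| ≤ 1) → InLoc blk (mulOp hI * Ml) U →
          InMajorant blk Pl T (fun y y'' => CN / (geomTB D).len y ^ 2 * Real.exp (-(δ * (geomTB D).dist y y''))) →
          (∀ (y'' : (geomTB D).Site) (μ : X → ℝ) (B : ℝ), BlockSupp blk μ y'' B → ∀ x, blk x ∈ T →
            |Pl μ x| ≤ CN / (geomTB D).len (blk x) ^ 2 * Real.exp (-(δ * (geomTB D).dist (blk x) y'')) * B) →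
          (∀ x, |ζ x| ≤ 1) → (∀ x, ζ x ≠ 0 → blk x ∈ U) →
          HasMajorant blk (mulOp hI * (Dg - Pl) * mulOp ζ)
            (fun y y'' => CD * Real.exp (-(cD * (geomTB D).M)) / (geomTB D).len y ^ 2 * Real.exp (-(δ * (geomTB D).dist y y''))) →
          HasMajorant blk (Lft * kDiagT Dg (mulOp hI) (mulOp ζ) Ml Pl)
            (fun y y' => ind U y * ind U y' *
              (Θ * (DE.card * (s₁ * C₁) + s₂ * CL + (DK.card + 1) * s * ((CN + 1) * CL * (1 + r₀)) + CD * CL / cD) *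
                ((geomTB D).M)⁻¹ * Real.exp (-(δ / 2 * (geomTB D).dist y y')))) := by
  obtain ⟨N₀, hN₀pos, h263⟩ := ineq263_geomTB d ℓ hδ
  obtain ⟨N₂, hthr⟩ := thr_geomTB d ℓ hδ
  obtain ⟨c, hc⟩ : ∃ c : ℝ, c = K261 N₀ (d + 1) ((ℓ : ℝ) + 1) 1 (1 / 3 * (3 / 4 * δ)) := ⟨_, rfl⟩
  obtain ⟨M₀, hM₀⟩ : ∃ M₀ : ℝ, M₀ = max ((N₀ : ℝ) + 1) ((N₂ : ℝ) + 1) := ⟨_, rfl⟩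
  obtain ⟨Θ, hΘ⟩ : ∃ Θ : ℝ, Θ = ((ℓ : ℝ) + 1) ^ 2 * (c ^ 2 * (8 / δ + 1) + 1) := ⟨_, rfl⟩
  have hΘnn : 0 ≤ Θ := by rw [hΘ]; positivity
  refine ⟨M₀, Θ, by rw [hM₀]; exact lt_max_of_lt_left (by positivity), hΘnn, ?_⟩
  intro Mh k R P D hMh hP hR hM X blk Dg CL C₁ CN CD cD s s₁ s₂ r₀ hCL hC₁ hCN hCD hcD hs hs₁ hs₂ hr₀ Lft Ml Pl hI c₀ ζ S T U ι DE E cf κ DK N z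
    hdecT hL hLE hLout hcf hcfS hc₀ hc₀S hIT hIU hLip hNin hNout hz hMin hPlin hPlout hζ hζU hD3
  have hMN₀ : (N₀ : ℝ) + 1 ≤ ((ℓ : ℝ) + 1) * Mh := (le_max_left _ _).trans (hM₀ ▸ hM)
  have hMN₂ : (N₂ : ℝ) + 1 ≤ ((ℓ : ℝ) + 1) * Mh := (le_max_right _ _).trans (hM₀ ▸ hM)
  have hMpos := M_pos_TB D hMh
  have h263D : Ineq263With c (geomTB D) (3 / 4 * δ) (1 / 3) := by rw [hc]; exact h263 D hMh hP hR hMN₀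
  -- `K̃_{□,□}` by name: its compact form (for the input localisation) and its decomposed form (for the majorant, by `hdecT`)
  have e : Lft * kDiagT Dg (mulOp hI) (mulOp ζ) Ml Pl =
      Lft * ((Ml * mulOp hI - mulOp hI * Ml) + mulOp hI * (Dg - Pl) * mulOp ζ + (mulOp hI * Pl - Pl * mulOp hI) * mulOp ζ) := by
    simp only [kDiagT]
  rw [e]
  have hin := compactL_inLoc blk Lft (Dg := Dg) (Pl := Pl) hIU hMin hζU
  have key0 := diagL_hasMajorant blk (one_le_L_TB D) (eta_pos_TB D) (levelSepTB D hMh hP (one_le_RLMh hMh hR)) (dist_nonneg_TB D hMh hP)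
    hδ hCL hC₁ hCN hCD hs hs₁ hs₂ hr₀ hMpos (RM_nonneg_TB D hMh hR) (hthr D hMh hR hMN₂) h263D DE DK hL hLE hcf hcfS hc₀ hc₀S hIT
    hLip hNin hNout hz hPlin hPlout hζ hD3
  have key : HasMajorant blk
      (Lft * ((Ml * mulOp hI - mulOp hI * Ml) + mulOp hI * (Dg - Pl) * mulOp ζ + (mulOp hI * Pl - Pl * mulOp hI) * mulOp ζ))
      (fun y y' => (((DE.card : ℝ) * (s₁ * C₁) + s₂ * CL) * (geomTB D).L ^ 2 / (geomTB D).M +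
          ((DK.card : ℝ) + 1) * (s / (geomTB D).M * (CN * CL * (geomTB D).L ^ 2 * (8 / δ + r₀)) * c ^ 2) +
            CD * Real.exp (-(cD * (geomTB D).M)) * CL * (geomTB D).L ^ 2 * c ^ 2) * Real.exp (-(1 / 2 * δ * (geomTB D).dist y y'))) := by
    rw [hdecT]
    exact key0
  have hK : ∀ y y' : (geomTB D).Site, 0 ≤ (((DE.card : ℝ) * (s₁ * C₁) + s₂ * CL) * (geomTB D).L ^ 2 / (geomTB D).M +
      ((DK.card : ℝ) + 1) * (s / (geomTB D).M * (CN * CL * (geomTB D).L ^ 2 * (8 / δ + r₀)) * c ^ 2) +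
        CD * Real.exp (-(cD * (geomTB D).M)) * CL * (geomTB D).L ^ 2 * c ^ 2) * Real.exp (-(1 / 2 * δ * (geomTB D).dist y y')) := by
    intro y y'; have := hMpos; positivity
  refine hasMajorant_mono _ (hasMajorant_ind_of_outLoc_inLoc blk hK key hLout hin) fun y y' => ?_
  refine mul_le_mul_of_nonneg_left ?_ (mul_nonneg (ind_nonneg _ _) (ind_nonneg _ _))
  have hθ := thetaT_pack_le (L := (geomTB D).L) (c := c) (CG := CL) (CH := CL) DE.card DK.card hMpos hδ hCN hCL hCL hC₁ hCD hcD hs hs₁ hs₂ hr₀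
  rw [geomTB_L] at hθ ⊢
  rw [← hΘ] at hθ
  have h1 : Real.exp (-(1 / 2 * δ * (geomTB D).dist y y')) = Real.exp (-(δ / 2 * (geomTB D).dist y y')) := by ring_nf
  rw [h1]
  exact mul_le_mul_of_nonneg_right hθ (Real.exp_nonneg _)

/-! ## §2  The reversed off-diagonal term behind a left factor on the torus -/

/-- algebra of multiplication operators: `(1 − ζ)·h·h = (1 − ζ)·(h²)·` as operators. [cite: Balaban1984PropagatorsII, (2.93) p.239, bookkeeping] -/
private theorem one_sub_mulOp_mul {X : Type} (z h : X → ℝ) :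
    (1 - mulOp z) * (mulOp h * mulOp h) = mulOp (fun x => 1 - z x) * mulOp (fun x => h x * h x) := by
  refine LinearMap.ext fun v => funext fun x => ?_
  simp only [Module.End.mul_apply, LinearMap.sub_apply, Module.End.one_apply, Pi.sub_apply, mulOp_apply]
  ring

/-- **(2.134) FOR THE REVERSED OFF-DIAGONAL TERM `Lft_{□′}·K̃_{□,□′}` (□ ≠ □′) ON THE TORUS, `K̃_{□,□′} = kOffT` BY NAME, WITH THE INDICATORS
`1_{□̃′}(y)1_{□̃}(y′)`**: under the (2.88)-shape majorant of `∂P∂*`, the global majorant `C_L(Lʲη)²e^{−δd}` of the left factor `Lft_{□′}` output-localised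
over `U_{□′}`, `|h_□| ≤ 1` supported over `U_□`, `0 ≤ ζ_{□′} ≤ 1` with `ζ_{□′} = 1` on the blocks of `Score′`, `|h_{□′}| ≤ 1` supported over `S′`, and the gap
`mM` read from the inside out — above ONE threshold: `HasMajorant blk (Lft_{□′}·K̃_{□,□′}) (1_{U′}(y)1_U(y′)·Θ·C_PC_L/(mM)·e^{−(δ/2)d})`.
[cite: Balaban1984PropagatorsII, (2.134) p.247; (2.93) p.239; (2.88) p.238; (2.137), (2.141) p.247; Lemma 2.1 p.234] -/
theorem ineq2134L_kOff_torus (d ℓ : ℕ) {δ : ℝ} (hδ : 0 < δ) :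
    ∃ M₀ Θ : ℝ, 0 < M₀ ∧ 0 ≤ Θ ∧
      ∀ {Mh k R : ℕ} {P : Fin (d + 1) → ℕ} (D : TDomains d ℓ Mh k P R), 1 ≤ Mh → (∀ μ, 1 ≤ P μ) → 2 * (ℓ + 1) ≤ R →
        M₀ ≤ ((ℓ : ℝ) + 1) * Mh → ∀ {X : Type} (blk : X → (geomTB D).Site) {CP CL m : ℝ}, 0 ≤ CP → 0 ≤ CL → 0 < m →
        ∀ {Dg Lft : Module.End ℝ (X → ℝ)} {hJ zJ hI : X → ℝ} {S Score UJ UI : Set (geomTB D).Site},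
          HasMajorant blk Dg (fun y y'' => CP / (geomTB D).len y ^ 2 * Real.exp (-(δ * (geomTB D).dist y y''))) →
          HasMajorant blk Lft (fun y y'' => CL * (geomTB D).len y ^ 2 * Real.exp (-(δ * (geomTB D).dist y y''))) →
          OutLoc blk Lft UJ →
          (∀ x, |hJ x| ≤ 1) → (∀ x, hJ x ≠ 0 → blk x ∈ S) →
          (∀ x, 0 ≤ zJ x) → (∀ x, zJ x ≤ 1) → (∀ x, zJ x ≠ 1 → blk x ∉ Score) →
          (∀ x, |hI x| ≤ 1) → (∀ x, hI x ≠ 0 → blk x ∈ UI) →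
          (∀ y'' b, y'' ∈ S → b ∉ Score → m * (geomTB D).M ≤ (geomTB D).dist y'' b) →
          HasMajorant blk (Lft * kOffT Dg (mulOp hI) (mulOp zJ) (mulOp hJ))
            (fun y y' => ind UJ y * ind UI y' * (Θ * CP * CL / m * ((geomTB D).M)⁻¹ * Real.exp (-(δ / 2 * (geomTB D).dist y y')))) := by
  obtain ⟨N₀, hN₀pos, h263⟩ := ineq263_geomTB d ℓ hδ
  obtain ⟨N₂, hthr⟩ := thr_geomTB d ℓ hδ
  obtain ⟨c, hc⟩ : ∃ c : ℝ, c = K261 N₀ (d + 1) ((ℓ : ℝ) + 1) 1 (1 / 3 * (3 / 4 * δ)) := ⟨_, rfl⟩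
  obtain ⟨M₀, hM₀⟩ : ∃ M₀ : ℝ, M₀ = max ((N₀ : ℝ) + 1) ((N₂ : ℝ) + 1) := ⟨_, rfl⟩
  obtain ⟨Θ, hΘ⟩ : ∃ Θ : ℝ, Θ = 8 * ((ℓ : ℝ) + 1) ^ 2 * c ^ 2 / δ := ⟨_, rfl⟩
  have hΘnn : 0 ≤ Θ := by rw [hΘ]; positivity
  refine ⟨M₀, Θ, by rw [hM₀]; exact lt_max_of_lt_left (by positivity), hΘnn, ?_⟩
  intro Mh k R P D hMh hP hR hM X blk CP CL m hCP hCL hm Dg Lft hJ zJ hI S Score UJ UI hDg hL hLout hJ1 hJS hz0 hz1 hzS hI1 hIU hgap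
  have hMN₀ : (N₀ : ℝ) + 1 ≤ ((ℓ : ℝ) + 1) * Mh := (le_max_left _ _).trans (hM₀ ▸ hM)
  have hMN₂ : (N₂ : ℝ) + 1 ≤ ((ℓ : ℝ) + 1) * Mh := (le_max_right _ _).trans (hM₀ ▸ hM)
  have hMpos := M_pos_TB D hMh
  have h263D : Ineq263With c (geomTB D) (3 / 4 * δ) (1 / 3) := by rw [hc]; exact h263 D hMh hP hR hMN₀
  -- `K̃_{□,□′}` by name, as the sandwich `(h_{□′}·∂P∂*·(1 − ζ_{□′}))·h_□²`
  have e : Lft * kOffT Dg (mulOp hI) (mulOp zJ) (mulOp hJ) =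
      Lft * (mulOp hJ * Dg * mulOp (fun x => 1 - zJ x)) * mulOp (fun x => hI x * hI x) := by
    simp only [kOffT, mul_assoc]
    rw [one_sub_mulOp_mul]
  rw [e]
  have hw1 : ∀ x, |1 - zJ x| ≤ 1 := fun x => by
    rw [abs_le]; constructor <;> linarith [hz0 x, hz1 x]
  have hwS : ∀ x, 1 - zJ x ≠ 0 → blk x ∉ Score := fun x hx => hzS x fun h1 => hx (by rw [h1, sub_self])
  have ha1 : ∀ x, |hI x * hI x| ≤ 1 := fun x => by
    rw [abs_mul]; nlinarith [abs_nonneg (hI x), hI1 x]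
  have haU : ∀ x, hI x * hI x ≠ 0 → blk x ∈ UI := fun x hx => hIU x (fun h0 => hx (by rw [h0, mul_zero]))
  have key := offDiagL_hasMajorant_ind blk (one_le_L_TB D) (eta_pos_TB D) (levelSepTB D hMh hP (one_le_RLMh hMh hR)) (dist_nonneg_TB D hMh hP)
    hδ.le hCP hCL (RM_nonneg_TB D hMh hR) (hthr D hMh hR hMN₂) h263D hDg hL hLout hJ1 hJS hw1 hwS ha1 haU hgap
  refine hasMajorant_mono _ key fun y y' => ?_
  refine mul_le_mul_of_nonneg_left ?_ (mul_nonneg (ind_nonneg _ _) (ind_nonneg _ _))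
  have hθ := theta_le (L := (geomTB D).L) (c := c) hδ hm hMpos hCP hCL
  have hid : 8 * CP * CL * (geomTB D).L ^ 2 * c ^ 2 / (δ * m) = Θ * CP * CL / m := by rw [hΘ, geomTB_L]; field_simp
  rw [hid] at hθ
  have h1 : Real.exp (-(1 / 2 * δ * (geomTB D).dist y y')) = Real.exp (-(δ / 2 * (geomTB D).dist y y')) := by ring_nf
  rw [h1]
  exact mul_le_mul_of_nonneg_right hθ (Real.exp_nonneg _)

/-! ## §3  All pairs of the reversed family behind a family of left factors, one threshold, one `Θ` -/

open Classical in
/-- **(2.134) FOR THE WHOLE REVERSED FAMILY `Lft_{□′}·K̃_{□,□′}` ON THE GENUINE MULTI-LEVEL TORUS — ALL PAIRS, ONE THRESHOLD `M₀`, ONE `Θ`** (gen 31's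
`h2134T_kFamT_torus` with the left factors abstracted): boxes `𝒟` with per-cube data `h_□, ζ_□, Lft_□, M_□, P_□`, sets `S_□ ⊆ T_□`, `U_□ = □̃`, `Score_□`,
the reversed family `K̃ = kFamT` BY NAME; hypotheses: the INPUT-side decomposition `hdecT` of `[M_□, h_□]`, the GLOBAL majorants of `Lft_□`, `Lft_□·E_e`
((2.133) shapes), `OutLoc Lft_□ U_□`, the coefficient sizes/supports, `h_□` block-Lipschitz, `|h_□| ≤ 1`, `supp h_□ ⊂ S_□`, `S_□ ⊆ T_□`, `S_□ ⊆ U_□`,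
partners `N_k`, `P_□` In/Out-localised over `T_□`, `InLoc (h_□M_□) U_□`, `0 ≤ ζ_□ ≤ 1`, `supp ζ_□ ⊂ U_□`, `ζ_□ = 1` on `Score_□`, the transposed line 3 per
cube, the gap `mM`, the (2.88)-shape `∂P∂*`; then for all members above ONE threshold and all pairs:
`HasMajorant blk (Lft_{□′}·K̃_{□,□′}) (1_{U′}(y)1_U(y′)·θ₀·e^{−(δ/2)d})`, `θ₀ = Θ·(C_PC_L/m + U)/M`.
[cite: Balaban1984PropagatorsII, (2.134)–(2.135) p.247; (2.91)–(2.93) p.239; (2.133), (2.137), (2.141) p.247; Lemma 2.1 p.234] -/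
theorem h2134L_kFamT_torus (d ℓ : ℕ) {δG : ℝ} (hδG : 0 < δG) :
    ∃ M₀ Θ : ℝ, 0 < M₀ ∧ 0 ≤ Θ ∧
      ∀ {Mh k R : ℕ} {P : Fin (d + 1) → ℕ} (D : TDomains d ℓ Mh k P R), 1 ≤ Mh → (∀ μ, 1 ≤ P μ) → 2 * (ℓ + 1) ≤ R →
        M₀ ≤ ((ℓ : ℝ) + 1) * Mh → ∀ {X : Type} (blk : X → (geomTB D).Site) {Dg : Module.End ℝ (X → ℝ)} {CP : ℝ}, 0 ≤ CP →
        HasMajorant blk Dg (fun y y'' => CP / (geomTB D).len y ^ 2 * Real.exp (-(δG * (geomTB D).dist y y''))) →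
        ∀ {CL C₁ CN CD cD s s₁ s₂ r₀ m : ℝ}, 0 ≤ CL → 0 ≤ C₁ → 0 ≤ CN → 0 ≤ CD → 0 < cD → 0 ≤ s → 0 ≤ s₁ → 0 ≤ s₂ → 0 ≤ r₀ → 0 < m →
        ∀ (nE nK : ℕ) {C : Type} [DecidableEq C] (Dc : Finset C) {Lft Ml Pl : C → Module.End ℝ (X → ℝ)} {h ζ c₀ : C → X → ℝ}
          {T S U Score : C → Set (geomTB D).Site}
          {ι : Type} {DE : C → Finset ι} {E : C → ι → Module.End ℝ (X → ℝ)} {cf : C → ι → X → ℝ}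
          {κ : Type} {DK : C → Finset κ} {N : C → κ → Module.End ℝ (X → ℝ)} {z : C → κ → X → ℝ},
          (∀ c ∈ Dc, (DE c).card ≤ nE) → (∀ c ∈ Dc, (DK c).card ≤ nK) →
          (∀ c ∈ Dc, Ml c * mulOp (h c) - mulOp (h c) * Ml c =
            (∑ e ∈ DE c, E c e * mulOp (cf c e) - mulOp (c₀ c)) + ∑ k ∈ DK c, (mulOp (h c) * N c k - N c k * mulOp (h c)) * mulOp (z c k)) →
          (∀ c ∈ Dc, HasMajorant blk (Lft c) (fun y y'' => CL * (geomTB D).len y ^ 2 * Real.exp (-(δG * (geomTB D).dist y y'')))) →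
          (∀ c ∈ Dc, ∀ e ∈ DE c,
            HasMajorant blk (Lft c * E c e) (fun y y' => C₁ * (geomTB D).len y ^ 2 * Real.exp (-(δG * (geomTB D).dist y y')))) →
          (∀ c ∈ Dc, OutLoc blk (Lft c) (U c)) →
          (∀ c ∈ Dc, ∀ e ∈ DE c, ∀ x, |cf c e x| ≤ s₁ / ((geomTB D).M * (geomTB D).len (blk x) ^ 2)) →
          (∀ c ∈ Dc, ∀ e ∈ DE c, ∀ x, cf c e x ≠ 0 → blk x ∈ S c) →
          (∀ c ∈ Dc, ∀ x, |c₀ c x| ≤ s₂ / ((geomTB D).M * (geomTB D).len (blk x) ^ 2)) → (∀ c ∈ Dc, ∀ x, c₀ c x ≠ 0 → blk x ∈ S c) →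
          (∀ c ∈ Dc, ∀ x, |h c x| ≤ 1) → (∀ c ∈ Dc, ∀ x, h c x ≠ 0 → blk x ∈ S c) → (∀ c ∈ Dc, S c ⊆ T c) → (∀ c ∈ Dc, S c ⊆ U c) →
          (∀ c ∈ Dc, ∀ x x', |h c x' - h c x| ≤ s / (geomTB D).M * ((geomTB D).dist (blk x) (blk x') + r₀)) →
          (∀ c ∈ Dc, ∀ k ∈ DK c,
            InMajorant blk (N c k) (T c) (fun y y'' => CN / (geomTB D).len y ^ 2 * Real.exp (-(δG * (geomTB D).dist y y'')))) →
          (∀ c ∈ Dc, ∀ k ∈ DK c, ∀ (y'' : (geomTB D).Site) (μ : X → ℝ) (B : ℝ), BlockSupp blk μ y'' B → ∀ x, blk x ∈ T c →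
            |N c k μ x| ≤ CN / (geomTB D).len (blk x) ^ 2 * Real.exp (-(δG * (geomTB D).dist (blk x) y'')) * B) →
          (∀ c ∈ Dc, ∀ k ∈ DK c, ∀ x, |z c k x| ≤ 1) → (∀ c ∈ Dc, InLoc blk (mulOp (h c) * Ml c) (U c)) →
          (∀ c ∈ Dc, InMajorant blk (Pl c) (T c) (fun y y'' => CN / (geomTB D).len y ^ 2 * Real.exp (-(δG * (geomTB D).dist y y'')))) →
          (∀ c ∈ Dc, ∀ (y'' : (geomTB D).Site) (μ : X → ℝ) (B : ℝ), BlockSupp blk μ y'' B → ∀ x, blk x ∈ T c →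
            |Pl c μ x| ≤ CN / (geomTB D).len (blk x) ^ 2 * Real.exp (-(δG * (geomTB D).dist (blk x) y'')) * B) →
          (∀ c ∈ Dc, ∀ x, 0 ≤ ζ c x) → (∀ c ∈ Dc, ∀ x, ζ c x ≤ 1) → (∀ c ∈ Dc, ∀ x, ζ c x ≠ 0 → blk x ∈ U c) →
          (∀ c ∈ Dc, ∀ x, ζ c x ≠ 1 → blk x ∉ Score c) →
          (∀ c ∈ Dc, HasMajorant blk (mulOp (h c) * (Dg - Pl c) * mulOp (ζ c))
            (fun y y'' => CD * Real.exp (-(cD * (geomTB D).M)) / (geomTB D).len y ^ 2 * Real.exp (-(δG * (geomTB D).dist y y'')))) →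
          (∀ c ∈ Dc, ∀ y'' b, y'' ∈ S c → b ∉ Score c → m * (geomTB D).M ≤ (geomTB D).dist y'' b) →
          ∀ c ∈ Dc, ∀ c' ∈ Dc,
            HasMajorant blk
              (Lft c' * kFamT Dg (fun c => mulOp (h c)) (fun c => mulOp (ζ c)) Ml Pl c c')
              (fun y y' => ind (U c') y * ind (U c) y' *
                (Θ * (CP * CL / m + (nE * (s₁ * C₁) + s₂ * CL + (nK + 1) * s * ((CN + 1) * CL * (1 + r₀)) + CD * CL / cD)) *
                  ((geomTB D).M)⁻¹ * Real.exp (-(δG / 2 * (geomTB D).dist y y')))) := by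
  obtain ⟨M₁, Θ₁, hM₁, hΘ₁, hoff⟩ := ineq2134L_kOff_torus d ℓ hδG
  obtain ⟨M₂, Θ₂, hM₂, hΘ₂, hdiag⟩ := ineq2134L_kDiag_torus d ℓ hδG
  refine ⟨max M₁ M₂, max Θ₁ Θ₂, lt_max_of_lt_left hM₁, le_max_of_le_left hΘ₁, ?_⟩
  intro Mh k R P D hMh hP hR hM X blk Dg CP hCP hDg CL C₁ CN CD cD s s₁ s₂ r₀ m hCL hC₁ hCN hCD hcD hs hs₁ hs₂ hr₀ hm nE nK C _ Dc Lft Ml Pl h ζ c₀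
    T S U Score ι DE E cf κ DK N z hnE hnK hdecT hL hLE hLout hcf hcfS hc₀ hc₀S hh1 hhS hST hSU hLip hNin hNout hz hMin hPlin hPlout hζ0 hζ1 hζU hζS
    hD3 hgap c hc c' hc'
  have hMi1 : M₁ ≤ ((ℓ : ℝ) + 1) * Mh := (le_max_left _ _).trans hM
  have hMi2 : M₂ ≤ ((ℓ : ℝ) + 1) * Mh := (le_max_right _ _).trans hM
  have hMpos : 0 < (geomTB D).M := M_pos_TB D hMh
  have hMinv : 0 ≤ ((geomTB D).M)⁻¹ := inv_nonneg.2 hMpos.le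
  set Upk : ℝ := nE * (s₁ * C₁) + s₂ * CL + (nK + 1) * s * ((CN + 1) * CL * (1 + r₀)) + CD * CL / cD with hU
  have hUnn : 0 ≤ Upk := by rw [hU]; positivity
  have hV : 0 ≤ CP * CL / m := div_nonneg (mul_nonneg hCP hCL) hm.le
  have hind0 : ∀ y y' : (geomTB D).Site, 0 ≤ ind (U c') y * ind (U c) y' := fun y y' => mul_nonneg (ind_nonneg _ _) (ind_nonneg _ _)
  -- the common kernel dominates both packs
  have hdom : ∀ {θ : ℝ} (y y' : (geomTB D).Site), 0 ≤ θ → θ ≤ max Θ₁ Θ₂ * (CP * CL / m + Upk) →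
      ind (U c') y * ind (U c) y' * (θ * ((geomTB D).M)⁻¹ * Real.exp (-(δG / 2 * (geomTB D).dist y y'))) ≤
        ind (U c') y * ind (U c) y' * (max Θ₁ Θ₂ * (CP * CL / m + Upk) * ((geomTB D).M)⁻¹ * Real.exp (-(δG / 2 * (geomTB D).dist y y'))) := by
    intro θ y y' hθ hθle
    exact mul_le_mul_of_nonneg_left (mul_le_mul_of_nonneg_right (mul_le_mul_of_nonneg_right hθle hMinv) (Real.exp_nonneg _)) (hind0 y y')
  have hζabs : ∀ x, |ζ c' x| ≤ 1 := fun x => abs_le.2 ⟨by linarith [hζ0 c' hc' x], hζ1 c' hc' x⟩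
  by_cases hcc : c = c'
  · -- the diagonal pair: `kDiagT`
    subst hcc
    rw [kFamT_of_eq]
    have key := hdiag D hMh hP hR hMi2 blk Dg hCL hC₁ hCN hCD hcD hs hs₁ hs₂ hr₀ (DE c) (DK c) (hdecT c hc) (hL c hc) (hLE c hc) (hLout c hc)
      (hcf c hc) (hcfS c hc) (hc₀ c hc) (hc₀S c hc) (fun x hx => hST c hc (hhS c hc x hx)) (fun x hx => hSU c hc (hhS c hc x hx)) (hLip c hc)
      (hNin c hc) (hNout c hc) (hz c hc) (hMin c hc) (hPlin c hc) (hPlout c hc) hζabs (hζU c hc) (hD3 c hc)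
    refine hasMajorant_mono _ key fun y y' => ?_
    have hUc : ((DE c).card : ℝ) * (s₁ * C₁) + s₂ * CL + ((DK c).card + 1) * s * ((CN + 1) * CL * (1 + r₀)) + CD * CL / cD ≤ Upk := by
      have h1 : ((DE c).card : ℝ) ≤ nE := by exact_mod_cast hnE c hc
      have h2 : ((DK c).card : ℝ) ≤ nK := by exact_mod_cast hnK c hc
      have h3 : 0 ≤ s₁ * C₁ := by positivity
      have h4 : 0 ≤ s * ((CN + 1) * CL * (1 + r₀)) := by positivity
      rw [hU]; nlinarith
    have hUc0 : 0 ≤ ((DE c).card : ℝ) * (s₁ * C₁) + s₂ * CL + ((DK c).card + 1) * s * ((CN + 1) * CL * (1 + r₀)) + CD * CL / cD := by positivity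
    refine hdom y y' (mul_nonneg hΘ₂ hUc0) ?_
    calc Θ₂ * (((DE c).card : ℝ) * (s₁ * C₁) + s₂ * CL + ((DK c).card + 1) * s * ((CN + 1) * CL * (1 + r₀)) + CD * CL / cD)
        ≤ max Θ₁ Θ₂ * Upk := mul_le_mul (le_max_right _ _) hUc hUc0 (le_trans hΘ₁ (le_max_left _ _))
      _ ≤ max Θ₁ Θ₂ * (CP * CL / m + Upk) := mul_le_mul_of_nonneg_left (by linarith) (le_trans hΘ₁ (le_max_left _ _))
  · -- an off-diagonal pair: `kOffT`
    rw [kFamT_of_ne _ _ _ _ _ hcc]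
    have key := hoff D hMh hP hR hMi1 blk hCP hCL hm (Dg := Dg) (Lft := Lft c') (S := S c') (Score := Score c') (UJ := U c') (UI := U c) hDg (hL c' hc')
      (hLout c' hc') (hh1 c' hc') (hhS c' hc') (hζ0 c' hc') (hζ1 c' hc') (hζS c' hc') (hh1 c hc) (fun x hx => hSU c hc (hhS c hc x hx)) (hgap c' hc')
    refine hasMajorant_mono _ key fun y y' => ?_
    have e1 : Θ₁ * CP * CL / m = Θ₁ * (CP * CL / m) := by ring
    rw [e1]
    refine hdom y y' (mul_nonneg hΘ₁ hV) ?_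
    calc Θ₁ * (CP * CL / m) ≤ max Θ₁ Θ₂ * (CP * CL / m) := mul_le_mul_of_nonneg_right (le_max_left _ _) hV
      _ ≤ max Θ₁ Θ₂ * (CP * CL / m + Upk) := mul_le_mul_of_nonneg_left (by linarith) (le_trans hΘ₁ (le_max_left _ _))

end Literature.MathematicalPhysics.QuantumFieldTheory.Balaban1983to89.B6Ineq2134TransposeLeftFactorTorus
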